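import Mathlib
import Summits.NavierStokesRegularity.NavierStokesRegularity.Theorems.FilamentSkeletonRssStadiumPairPositivity
import Summits.NavierStokesRegularity.NavierStokesRegularity.Theorems.FilamentSkeletonRssStadiumPairAveraging
import Summits.NavierStokesRegularity.NavierStokesRegularity.Theorems.FilamentSkeletonRssStadiumLegProfiles
import Summits.NavierStokesRegularity.NavierStokesRegularity.Theorems.FilamentSkeletonRssStadiumStepProfile
import Summits.NavierStokesRegularity.NavierStokesRegularity.Theorems.FilamentSkeletonRssStadiumPartnerPiece

/-!
# Route `FilamentSkeletonRss` · child crux `TangentSkeletonNearStraightL` (stmt-NavierStokesRegularity-23320) · registered line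
# `child_tangent_analytic_strip_L` (b0b56c52900dd90a), stub `stub_stripPropagation` — assembly piece: LONG PLATEAU CHORDS WITH A TWO-LEVEL PROFILE

Second assembly piece of the quarter-width blueprint (evidence `CORNER-QUARTER-BLUEPRINT-leafhand-15-g0.md` on 23320), in the stub's own terms.
`Theorems.StadiumPlateauShortChord` puts the plateau chords with `M|s| ≤ 2d` on the principal branch for every `Rb`; the LONG plateau chords
through the registered output corner are where the sup-form deviation estimate of the landed `strip_core` architecture fails
(`(Rb+2E)²/2 = 9/8` at disc ratio 3).  Here the chord `[z − ℓ, z]` at height `Y` is split in halves with admissible disc radii `R₁` (near `z`)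
and `R₂` (far half), the real-part deviations are bounded by the two LEVELS `E₁ ≥ √3·2M(log(R₁/(R₁−Y)) − Y/R₁)`, `E₂ ≥ …R₂…`
(`Theorems.StadiumLegProfiles.leg_profile_bounds`), the pair products by `Theorems.StadiumPairPositivity.re_dot_ge_of_le`, and the mean by the
integrable pair-averaging principle (`Theorems.StadiumPairAveraging.sum_sq_mean_re_ge_of_pairwise_integrable`) with the exact two-level double
mean (`Theorems.StadiumStepProfile.step2_double_mean_eq`):
  `ℓ²·(1 − ((Rb+2E₁)² + 2(Rb+E₁+E₂)² + (Rb+2E₂)²)/8) ≤ Re Σᵢ (Fᵢ(z−ℓ) − Fᵢ(z))²`   (`plateau_step_chord_re_ge`).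
At the registered corner (`Rb = 1/2`, `E₁ = 1/2`, `E₂ = 27/100`, `Theorems.StadiumStepProfile.corner_left_double_mean_lt_one`) the bracket is
`> 9/50 > 0`: together with `StadiumPlateauShortChord` the whole LEFT side of the corner is on the principal branch.
HONEST FRAMING: bookkeeping for a HYPOTHETICAL filament skeleton on the NEGATIVE side of a MODEL route; the stub `stub_stripPropagation` is NOT
closed by this file; nothing here bears on Navier–Stokes regularity or blow-up.  `--supports stmt-NavierStokesRegularity-23320`.
-/

set_option linter.dupNamespace false

noncomputable section

namespace Summit.NavierStokesRegularity.NavierStokesRegularity.Theorems.StadiumPlateauStepChord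

open Set MeasureTheory
open scoped InnerProductSpace BigOperators
open Summit.NavierStokesRegularity.NavierStokesRegularity.Theorems.StadiumPairPositivity
open Summit.NavierStokesRegularity.NavierStokesRegularity.Theorems.StadiumPairAveraging
open Summit.NavierStokesRegularity.NavierStokesRegularity.Theorems.StadiumLegProfiles
open Summit.NavierStokesRegularity.NavierStokesRegularity.Theorems.StadiumStepProfile
open Summit.NavierStokesRegularity.NavierStokesRegularity.Theorems.StadiumDeviationPackage
open Summit.NavierStokesRegularity.NavierStokesRegularity.Theorems.StadiumPartnerPiece

/-- **Long plateau chord with a two-level deviation profile.**  Stadium `S = {|Im| < hs, |Re − cc| < L + hs}`, `F` holomorphic on `S` with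
`‖F′‖ ≤ M`, `Σ (F′)ᵢ² = 1`, `F = cplx ∘ X` on the real trace for a differentiable unit-speed `X` with tangent oscillation `≤ Rb`; a target
`z = x₀ + iY` (`0 ≤ Y`) and the horizontal chord to `z − ℓ`; admissible disc radii `R₁` on the near half (`r ≤ 1/2`) and `R₂` on the far half
of the chord `r ↦ x₀ − rℓ` (`Y < Rⱼ < hs`, `|x₀ − rℓ − cc| + Rⱼ < L + hs`), and levels `E₁, E₂` dominating the second-order profiles at height `Y`.
Then `ℓ²·(1 − ((Rb+2E₁)² + 2(Rb+E₁+E₂)² + (Rb+2E₂)²)/8) ≤ Re Σᵢ (Fᵢ(z−ℓ) − Fᵢ(z))²`. [folklore] -/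
theorem plateau_step_chord_re_ge {hs L cc M : ℝ} {F : ℂ → (Fin 3 → ℂ)}
    (hF : DifferentiableOn ℂ F {z : ℂ | |z.im| < hs ∧ |z.re - cc| < L + hs})
    (hM : ∀ z ∈ {z : ℂ | |z.im| < hs ∧ |z.re - cc| < L + hs}, ‖deriv F z‖ ≤ M)
    (hunit : ∀ w ∈ {z : ℂ | |z.im| < hs ∧ |z.re - cc| < L + hs}, ∑ i, (deriv F w i) ^ 2 = 1)
    {X : ℝ → EuclideanSpace ℝ (Fin 3)} (hX : Differentiable ℝ X) (hXu : ∀ τ, ‖deriv X τ‖ = 1)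
    {Rb : ℝ} (hosc : ∀ τ σ, ‖deriv X τ - deriv X σ‖ ≤ Rb)
    (hFX : ∀ r : ℝ, (r : ℂ) ∈ {z : ℂ | |z.im| < hs ∧ |z.re - cc| < L + hs} →
      F r = fun i => ((⟪X r, EuclideanSpace.single i (1:ℝ)⟫_ℝ : ℝ) : ℂ))
    (hhs : 0 < hs) {x₀ Y ℓ R₁ R₂ E₁ E₂ : ℝ} (hY : 0 ≤ Y)
    (hR₁Y : Y < R₁) (hR₁hs : R₁ < hs) (hR₂Y : Y < R₂) (hR₂hs : R₂ < hs)
    (hnear : ∀ r ∈ Icc (0:ℝ) 1, r ≤ 1 / 2 → |x₀ + r * (-ℓ) - cc| + R₁ < L + hs)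
    (hfar : ∀ r ∈ Icc (0:ℝ) 1, 1 / 2 < r → |x₀ + r * (-ℓ) - cc| + R₂ < L + hs)
    (hE₁ : √3 * (2 * M * (Real.log (R₁ / (R₁ - Y)) - Y / R₁)) ≤ E₁)
    (hE₂ : √3 * (2 * M * (Real.log (R₂ / (R₂ - Y)) - Y / R₂)) ≤ E₂) :
    ℓ ^ 2 * (1 - ((Rb + 2 * E₁) ^ 2 + 2 * (Rb + E₁ + E₂) ^ 2 + (Rb + 2 * E₂) ^ 2) / 8) ≤
      (∑ i, (F (((x₀ : ℂ) + (Y : ℂ) * Complex.I) + ((-ℓ : ℝ) : ℂ)) i - F ((x₀ : ℂ) + (Y : ℂ) * Complex.I) i) ^ 2).re := by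
  set S : Set ℂ := {z : ℂ | |z.im| < hs ∧ |z.re - cc| < L + hs} with hS
  have hSo : IsOpen S := isOpen_stadium hs (L + hs) cc
  set z : ℂ := (x₀ : ℂ) + (Y : ℂ) * Complex.I with hz
  set s : ℂ := ((-ℓ : ℝ) : ℂ) with hsdef
  -- chord points in foot/height form
  have hpt : ∀ r : ℝ, z + (r : ℂ) * s = ((x₀ + r * (-ℓ) : ℝ) : ℂ) + (Y : ℂ) * Complex.I := by
    intro r; simp only [hz, hsdef]; push_cast; ring
  have hx : ∀ r ∈ Icc (0:ℝ) 1, |x₀ + r * (-ℓ) - cc| < L + hs := by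
    intro r hr
    rcases le_or_gt r (1 / 2) with h | h
    · have := hnear r hr h; linarith
    · have := hfar r hr h; linarith
  have hseg : ∀ r ∈ Icc (0:ℝ) 1, z + (r : ℂ) * s ∈ S := by
    intro r hr
    rw [hpt r]
    refine ⟨?_, ?_⟩
    · simp only [Complex.add_im, Complex.ofReal_im, Complex.mul_im, Complex.ofReal_re, Complex.I_im, Complex.I_re,
        mul_one, mul_zero, zero_add, add_zero]
      rw [abs_of_nonneg hY]; linarith
    · simp only [Complex.add_re, Complex.ofReal_re, Complex.mul_re, Complex.ofReal_im, Complex.I_re, Complex.I_im,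
        mul_zero, mul_one, sub_zero, add_zero]
      exact hx r hr
  obtain ⟨ha, hFTC⟩ := chord_eq_mul_mean_deriv hSo hF hseg
  -- tangent field and two-level profile
  set T : ℝ → Fin 3 → ℝ := fun r i => ⟪deriv X (x₀ + r * (-ℓ)), EuclideanSpace.single i (1:ℝ)⟫_ℝ with hT
  set e : ℝ → ℝ := fun r => if r ≤ 1 / 2 then E₁ else E₂ with hedef
  have hTu : ∀ r, ∑ i, T r i ^ 2 = 1 := fun r => (unit_tangent_coords hXu hosc (x₀ + r * (-ℓ)) 0).1
  have hρ : ∀ r r', √(∑ i, (T r i - T r' i) ^ 2) ≤ Rb := fun r r' =>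
    (unit_tangent_coords hXu hosc (x₀ + r * (-ℓ)) (x₀ + r' * (-ℓ))).2
  have he : ∀ r ∈ Icc (0:ℝ) 1,
      √(∑ i, ((deriv F (z + (r : ℂ) * s) i).re - T r i) ^ 2) ≤ e r := by
    intro r hr
    rw [hpt r]
    rcases le_or_gt r (1 / 2) with h | h
    · have hb := (leg_profile_bounds hF hM hX hFX hhs (lt_of_le_of_lt hY hR₁Y) hR₁hs (hnear r hr h) hY hR₁Y).2
      simp only [hedef, if_pos h]
      exact hb.trans hE₁
    · have hb := (leg_profile_bounds hF hM hX hFX hhs (lt_of_le_of_lt hY hR₂Y) hR₂hs (hfar r hr h) hY hR₂Y).2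
      simp only [hedef, if_neg (not_le.2 h)]
      exact hb.trans hE₂
  -- pointwise pair bound
  have hpair : ∀ r ∈ Icc (0:ℝ) 1, ∀ r' ∈ Icc (0:ℝ) 1,
      1 - (Rb + (if r ≤ 1 / 2 then E₁ else E₂) + (if r' ≤ 1 / 2 then E₁ else E₂)) ^ 2 / 2 ≤
        (∑ i, deriv F (z + (r : ℂ) * s) i * deriv F (z + (r' : ℂ) * s) i).re := by
    intro r hr r' hr'
    exact re_dot_ge_of_le _ _ (T r) (T r') (hunit _ (hseg r hr)) (hunit _ (hseg r' hr')) (hTu r) (hTu r')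
      (hρ r r') (he r hr) (he r' hr')
  -- integrable pair averaging with the exact two-level double mean
  obtain ⟨hφi, hΦi, hval⟩ := step2_double_mean_eq Rb E₁ E₂
  have hP := sum_sq_mean_re_ge_of_pairwise_integrable ha hφi hΦi hpair
  rw [hval] at hP
  -- `Q = s²·P`, `s` real
  set P : ℂ := ∑ i, (∫ r in (0:ℝ)..1, deriv F (z + (r : ℂ) * s) i) ^ 2 with hPdef
  have hsum : (∑ i, (F (z + s) i - F z i) ^ 2) = s ^ 2 * P := by
    simp only [hPdef, Fin.sum_univ_three, hFTC]
    ring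
  have hs2 : s ^ 2 = ((ℓ ^ 2 : ℝ) : ℂ) := by simp only [hsdef]; push_cast; ring
  rw [hsum, hs2, Complex.re_ofReal_mul]
  exact mul_le_mul_of_nonneg_left hP (sq_nonneg ℓ)

end Summit.NavierStokesRegularity.NavierStokesRegularity.Theorems.StadiumPlateauStepChord

end
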